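import Mathlib
import HarnessLib
import Summits.Ventures.LatticeQCDFlow.Scoring.SingleRunMedianOfBlocks
import Summits.Ventures.LatticeQCDFlow.Scoring.FlowSamplerAutocorrelation

/-!
# The exact flow sampler certifies exponential-confidence error bars from ONE cold-start run —
# UNCONDITIONAL on `SU(n)^E`: median of blocks, regeneration rate `e^{−2δ}`

HONEST FRAMING: exact (Metropolis-corrected) sampling algorithms for lattice gauge theory;
figures of merit are autocorrelation/cost numbers at stated couplings and volumes; no
continuum-physics claim.

Venture `LatticeQCDFlow` (cell pub-lqcd), topic `Scoring`; FANOUT row 8 (`s0-cpn-nemc`, GEN-15).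
NEW WORK of the cell, not a published result; no definition is introduced.  The SU(n)^E instance of
the single-run median-of-blocks certificate `Scoring/SingleRunMedianOfBlocks.lean`
(`chain_medianOfBlocks_confidence_of_doeblin`), composed with the tree's exact flow-MCMC theorem
`Exactness.flowSampler_exact_doeblin` (row 30 / lean-2, UNCONDITIONAL via `jacobianFormula_holds`:
Doeblin constant `e^{−2δ}` by the target `π` itself from a uniform defect `δ` of Lüscher's flow
equation).  `Scoring/FlowSamplerParallel.lean` (`flowSampler_replicas`) had the exponential
confidence for `R` INDEPENDENT flow-sampler runs; here ONE run suffices, the independence being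
supplied by the regenerations of the split chain (`Scoring/SplitChain*.lean`).  Nothing is cited as
a fact.

## Content (hypotheses of `Scoring.flowSampler_autocorrelation` with `δ > 0`; `K = indepMH q w`
## EXACT for `π = 𝒵⁻¹e^{−S}D[U]`; ONE run of `K` from ANY initial law `μ₀`; `|f| ≤ C`,
## `C' = C + |πf|`, `Var_π f = ∫ (f − πf)² dπ`; blocks `j < R` of `N ≥ 1` configurations at times
## `j(N+g), …, j(N+g)+N−1`, gaps of `g` configurations between them;
## `MSE_N = (2e^{2δ} − 1)·Var_π f/N + 16 C'² e^{4δ}/N²` written with `e = e^{−2δ}`)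

* **`flowSampler_medianOfBlocks`** — if `4 MSE_N ≤ s²` then
  `P_{μ₀}( #{j < R : s ≤ |(1/N) Σ_{i<N} f(U_{j(N+g)+i}) − πf|} ≥ R/2 ) ≤ (R − 1)(1 − e^{−2δ})^g + e^{−R/8}`
  — the median of the `R` block means of one exact flow-MCMC run from a cold start is within `s` of
  `πf` except on an event of that probability.

Reading (value-free): a certified defect `δ` prices a complete single-run error-bar protocol for the
exact flow sampler — block length from `4 MSE_N ≤ s²`, gap `g ≈ e^{2δ} log(R/η)`, `R ≈ 8 log(1/η)`
blocks — with no variance, autocorrelation or acceptance measurement entering the guarantee.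
NOT CLAIMED: any value of `δ`; optimal constants; unbounded observables; `δ = 0` (then `K` is the
independent sampler and `Scoring/ReplicaChains.lean` applies directly).
-/

noncomputable section

namespace Summit.Ventures.LatticeQCDFlow.Scoring

open MeasureTheory ProbabilityTheory Filter Finset Summit.Ventures.LatticeQCDFlow.Exactness
open Literature.MathematicalPhysics.QuantumFieldTheory
open Literature.MathematicalPhysics.QuantumFieldTheory.Luscher2010
open Summit.Ventures.LatticeQCDFlow.TrivializingMaps
open scoped ENNReal Matrix Matrix.Norms.Frobenius ContDiff

variable {d L n : ℕ} [NeZero L]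

/-- **ONE exact flow-MCMC run certifies its own exponential-confidence error bar — UNCONDITIONAL,
any start.**  See the module docstring. -/
theorem flowSampler_medianOfBlocks (B : SuBasis n)
    {S : AmbConfig d L n → ℝ} (hS : ContDiff ℝ ∞ S) {F : ℝ → AmbConfig d L n → ℝ}
    (hF : ContDiff ℝ ∞ fun p : ℝ × AmbConfig d L n => F p.1 p.2)
    {Φ : ℝ → GaugeConfig d L (Matrix.specialUnitaryGroup (Fin n) ℂ) →
      GaugeConfig d L (Matrix.specialUnitaryGroup (Fin n) ℂ)}
    (hΦ : IsFlowMap (fun t W => -linkGrad B (F t) W) Φ) {c : ℝ → ℝ} {δ : ℝ} (hδ0 : 0 < δ)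
    (hδ : ∀ t ∈ Set.Icc (0 : ℝ) 1, ∀ U : GaugeConfig d L (Matrix.specialUnitaryGroup (Fin n) ℂ),
      |luscherL B S t (F t) (WilsonFlow.coeConfig U) - S (WilsonFlow.coeConfig U) - c t| ≤ δ)
    (q : Measure (GaugeConfig d L (Matrix.specialUnitaryGroup (Fin n) ℂ))) [IsProbabilityMeasure q]
    (hq : q = Measure.map (Φ 1) (trivialMeasure (Matrix.specialUnitaryGroup (Fin n) ℂ) d L)) :
    ∃ w : GaugeConfig d L (Matrix.specialUnitaryGroup (Fin n) ℂ) → ℝ, ∃ hw : Measurable w,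
      (q.withDensity fun U => ENNReal.ofReal (w U)) =
        boltzmannMeasure (fun U : GaugeConfig d L (Matrix.specialUnitaryGroup (Fin n) ℂ) =>
          S (WilsonFlow.coeConfig U)) ∧
      Kernel.Invariant (indepMH q w)
        (boltzmannMeasure fun U : GaugeConfig d L (Matrix.specialUnitaryGroup (Fin n) ℂ) =>
          S (WilsonFlow.coeConfig U)) ∧
      ∀ (μ₀ : Measure (GaugeConfig d L (Matrix.specialUnitaryGroup (Fin n) ℂ))) [IsProbabilityMeasure μ₀]
        (f : GaugeConfig d L (Matrix.specialUnitaryGroup (Fin n) ℂ) → ℝ), Measurable f →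
        ∀ C : ℝ, (∀ U, |f U| ≤ C) → ∀ N : ℕ, N ≠ 0 → ∀ (g R : ℕ) (s : ℝ), 0 < s →
        let π := boltzmannMeasure fun U : GaugeConfig d L (Matrix.specialUnitaryGroup (Fin n) ℂ) =>
          S (WilsonFlow.coeConfig U)
        haveI : Fact (Measurable w) := ⟨hw⟩
        4 * ((2 / Real.exp (-(2 * δ)) - 1) * (∫ V, (f V - ∫ V', f V' ∂π) ^ 2 ∂π) / N
            + 16 * (C + |∫ V, f V ∂π|) ^ 2 / (Real.exp (-(2 * δ)) ^ 2 * (N : ℝ) ^ 2)) ≤ s ^ 2 →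
        (Kernel.trajMeasure
            (X := fun _ : ℕ => GaugeConfig d L (Matrix.specialUnitaryGroup (Fin n) ℂ)) μ₀
            (fun j : ℕ => (indepMH q w).comap
              (fun y : (i : ↥(Finset.Iic j)) → GaugeConfig d L (Matrix.specialUnitaryGroup (Fin n) ℂ) =>
                y ⟨j, Finset.mem_Iic.2 le_rfl⟩) (measurable_pi_apply _))).real
          {y | (R : ℝ) / 2 ≤ ∑ j ∈ Finset.range R,
            (if s ≤ |(∑ i ∈ Finset.range N, f (y (j * (N + g) + i))) / N - ∫ V, f V ∂π|
              then (1 : ℝ) else 0)}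
          ≤ ((R - 1 : ℕ) : ℝ) * (1 - Real.exp (-(2 * δ))) ^ g + Real.exp (-((R : ℝ) / 8)) := by
  obtain ⟨w, hw, -, -, hπ, hinv, -, hdoeb⟩ := flowSampler_exact_doeblin B hS hF hΦ hδ q hq
  haveI : Fact (Measurable w) := ⟨hw⟩
  have hS'c : Continuous fun U : GaugeConfig d L (Matrix.specialUnitaryGroup (Fin n) ℂ) =>
      S (WilsonFlow.coeConfig U) := hS.continuous.comp WilsonFlow.continuous_coeConfig
  haveI := isProbabilityMeasure_boltzmannMeasure (d := d) (L := L) hS'c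
  have hε0 : 0 < ENNReal.ofReal (Real.exp (-(2 * δ))) := ENNReal.ofReal_pos.2 (Real.exp_pos _)
  have hε1 : ENNReal.ofReal (Real.exp (-(2 * δ))) < 1 := by
    rw [ENNReal.ofReal_lt_one]
    exact Real.exp_lt_one_iff.2 (by linarith)
  have hr : (ENNReal.ofReal (Real.exp (-(2 * δ)))).toReal = Real.exp (-(2 * δ)) :=
    ENNReal.toReal_ofReal (Real.exp_pos _).le
  refine ⟨w, hw, hπ, hinv, fun μ₀ _ f hf C hC N hN g R s hs hsmall => ?_⟩
  have h := chain_medianOfBlocks_confidence_of_doeblin (κ := indepMH q w) hinv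
    (fun x B hB => hdoeb x hB) hε0 hε1 hf hC hN g R hs (by rw [hr]; exact hsmall) μ₀
  rw [hr] at h
  exact h

end Summit.Ventures.LatticeQCDFlow.Scoring

end
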